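import Summits.Ventures.HodgeRepro2.T5SU11RadialGreenKernel
import Summits.Ventures.HodgeRepro2.T5SU11SphericalGreenEdge

/-!
# The resolvent is a negative operator: `f ≥ 0 ⇒ G f ≤ 0`

The Green's kernel `K(t, s) = −φ(min(t, s)) χ(max(t, s))` of row 461 is NEGATIVE when the two basis solutions are
positive, so the Green's solution of a non-negative source is non-positive:

  **`f ≥ 0` on `(0, ∞)`, supported in `[a, b]` ⟹ `(G f)(t) ≤ 0` for every `t > 0`**  (`greenSol_nonpos`),

on `[a, b]` from the two non-negative integrals in `G f = −χ B − φ A`, outside from the boundary forms of row 451.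
For the explicit model (`φ_λ(a_·) > 0`, `χ_λ > 0` for `λ ≥ 1`): **`G_λ f ≤ 0`** (`sphGreen_nonpos`,
`sphGreen_one_nonpos`) — the resolvent `(L − λ(λ − 2))⁻¹` of the radial Laplacian `L = ∂² + 2 coth 2t ∂` at the
spectral parameter `λ(λ − 2) ≥ −1 = −ρ²` is a negative operator, as it must be for `L ≤ −ρ²`. Nothing is claimed
about (N).

Blind lane: Mathlib + the HodgeRepro2 prefix only; no sorry; axioms ⊆ {propext, Classical.choice,
Quot.sound}.
-/

namespace Summit.Ventures.HodgeRepro2.T5SU11RadialGreenPositivity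

open intervalIntegral
open Set (Ioi Icc)
open T5SU11Cartan T5SU11SphericalFunction T5SU11SphericalBounds T5SU11ReductionOfOrder
  T5SU11SphericalSolutionSpaceAll T5SU11SphericalDecay T5SU11SphericalDecayEdge T5SU11RadialGreen
  T5SU11SphericalGreen

section

variable {a b : ℝ} {φ φ' χ χ' f : ℝ → ℝ}
  (hφ : ∀ t, 0 < t → HasDerivAt φ (φ' t) t) (hχ : ∀ t, 0 < t → HasDerivAt χ (χ' t) t)
  (hφpos : ∀ t, 0 < t → 0 < φ t) (hχpos : ∀ t, 0 < t → 0 < χ t)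
  (hf : ContinuousOn f (Ioi 0)) (hf0 : ∀ t, 0 < t → 0 ≤ f t) (ha : 0 < a) (hab : a ≤ b)
  (hfa : ∀ s, s ≤ a → f s = 0) (hfb : ∀ s, b ≤ s → f s = 0)

include hφpos hf0 in
/-- `∫_c^d φ f sinh 2s ≥ 0` for `0 < c ≤ d`. -/
theorem integral_nonneg_of_pos {c d : ℝ} (hc : 0 < c) (hcd : c ≤ d) :
    0 ≤ ∫ s in c..d, φ s * f s * Real.sinh (2 * s) := by
  refine integral_nonneg hcd (fun s hs => ?_)
  have hs0 : 0 < s := lt_of_lt_of_le hc hs.1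
  exact mul_nonneg (mul_nonneg (hφpos s hs0).le (hf0 s hs0)) (sinh_two_mul_pos hs0).le

include hφ hχ hφpos hχpos hf hf0 ha hab hfa hfb in
/-- **`G f ≤ 0` on `(0, ∞)` for a non-negative source supported in `[a, b]`.** -/
theorem greenSol_nonpos {t : ℝ} (ht : 0 < t) : greenSol φ χ f a b t ≤ 0 := by
  have hb : 0 < b := lt_of_lt_of_le ha hab
  rcases le_or_gt t a with hta | hat
  · -- `t ≤ a`: `G f = −(∫_a^b χ f sinh) φ(t)`
    rw [greenSol_eq_of_le hχ hf ha hab hfa ht hta]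
    have h1 := integral_nonneg_of_pos (φ := χ) hχpos hf0 ha hab
    have h2 := (hφpos t ht).le
    nlinarith
  rcases le_or_gt b t with htb | htb
  · -- `t ≥ b`: `G f = −(∫_a^b φ f sinh) χ(t)`
    rw [greenSol_eq_of_ge hφ hf ha hab hfb htb]
    have h1 := integral_nonneg_of_pos hφpos hf0 ha hab
    have h2 := (hχpos t ht).le
    nlinarith
  · -- `a < t < b`: both integrals are non-negative
    unfold greenSol greenB greenA
    have h1 := integral_nonneg_of_pos hφpos hf0 ha hat.le
    have h2 := integral_nonneg_of_pos (φ := χ) hχpos hf0 ht htb.le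
    have h3 := (hχpos t ht).le
    have h4 := (hφpos t ht).le
    nlinarith [mul_nonneg h3 h1, mul_nonneg h4 h2]

end

section measure

variable [MeasurableSpace Circle] [BorelSpace Circle]

/-- **The resolvent at `λ > 1` is a negative operator**: `f ≥ 0` supported in `[a, b]` ⟹ `G_λ f ≤ 0`. -/
theorem sphGreen_nonpos {lam a b : ℝ} {f : ℝ → ℝ} (hlam : 1 < lam) (hf : ContinuousOn f (Ioi 0))
    (hf0 : ∀ t, 0 < t → 0 ≤ f t) (ha : 0 < a) (hab : a ≤ b) (hfa : ∀ s, s ≤ a → f s = 0)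
    (hfb : ∀ s, b ≤ s → f s = 0) {t : ℝ} (ht : 0 < t) : sphGreen lam f a b t ≤ 0 :=
  greenSol_nonpos (hφ_sph lam) (fun _ ht => hasDerivAt_sphDecay hlam ht) (hpos_sph lam)
    (fun _ ht => sphDecay_pos hlam ht) hf hf0 ha hab hfa hfb ht

/-- **The resolvent at the edge `λ = 1` is a negative operator.** -/
theorem sphGreen_one_nonpos {a b : ℝ} {f : ℝ → ℝ} (hf : ContinuousOn f (Ioi 0))
    (hf0 : ∀ t, 0 < t → 0 ≤ f t) (ha : 0 < a) (hab : a ≤ b) (hfa : ∀ s, s ≤ a → f s = 0)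
    (hfb : ∀ s, b ≤ s → f s = 0) {t : ℝ} (ht : 0 < t) : sphGreen 1 f a b t ≤ 0 :=
  greenSol_nonpos (hφ_sph 1) (fun _ ht => hasDerivAt_sphDecay_one ht) (hpos_sph 1)
    (fun _ ht => sphDecay_one_pos ht) hf hf0 ha hab hfa hfb ht

/-- The Green's kernel of the explicit model is negative for `λ > 1` (and `t > 0`). -/
theorem sphGreenKernel_neg {lam : ℝ} (hlam : 1 < lam) {t s : ℝ} (ht : 0 < t) :
    T5SU11RadialGreenKernel.sphGreenKernel lam t s < 0 := by
  unfold T5SU11RadialGreenKernel.sphGreenKernel T5SU11RadialGreenKernel.greenKernel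
  have h1 : 0 < sph lam (hyp (min t s)) := sph_hyp_pos lam _
  have h2 : 0 < sphDecay lam (max t s) := sphDecay_pos hlam (lt_max_of_lt_left ht)
  have := mul_pos h1 h2
  linarith

end measure

end Summit.Ventures.HodgeRepro2.T5SU11RadialGreenPositivity
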